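import Summits.BirchSwinnertonDyer.BirchSwinnertonDyer.Theorems.ThetaPartnerAtTwoSignedKatoUpToAtTwoIwasawaInvolutionCompat
import Literature.NumberTheory.EllipticCurves.Kato2004.IwasawaCohomology
import HarnessLib

/-!
# Route `ThetaPartnerAtTwo` (TP2), crux K3 `SignedKatoDivisibilityUpToAtTwo` (item stmt-BirchSwinnertonDyer-20308),
# line `colemanrat` v5 — the `γ ↦ γ⁻¹` TWIST OF KATO's PINNED IWASAWA COHOMOLOGY `Kato2004.IwasawaH1Data W p κ γ`
# is its `ι`-twist, and the transport of `ℓ_𝔭(𝐇¹ ⧸ Λs)` (quotients by a submodule) along a semilinear isomorphism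

Width seat `bsd-wall-tp2-p2x-w3` g3 (cell `bsd-wall`). HONEST FRAMING: THEOREMS ONLY — no definition, no named fact, no
instance, no `sorry`; route-independent; closes no item; BSD is NOT proved by any of this.

## Why this file

Companion of `…IwasawaInvolutionTwist` (twists of the DUAL data `SignedSelmerDualData` / `FineSelmerDualData`). The covariant
side of the K3 chain is Kato's `I : Kato2004.IwasawaH1Data W p κ γ` (`T` acts as `conj_γ − 1` on every layer `H¹(ℚ_n, T_pW)`,
`proj_T_smul`). Its `γ ↦ γ⁻¹` twist `I′ : IwasawaH1Data W p κ δ` (`γδ = 1`) on the SAME group with the SAME layer projections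
(`I′.proj n ∘ e = I.proj n`, so Euler-system-class predicates `IsEulerSystemClassTwo`, which only read `proj`, transfer
verbatim) and `Λ`-structure twisted by `ι` exists by the same one-line algebra as for the duals (`1 + T` is a unit, `conj` is an
action: `conjMap_mul_apply_one`, `conjMap_one_apply_of_mem`). USE: the convention audit's third print-exact variant
«twist `𝐇¹` instead of the duals» (K2″: `I : IwasawaH1Data κ γ⁻¹` against `Y : FineSelmerDualData κ γ`; R2″: a `Λ`-LINEAR
Poitou–Tate map `I′.H → D.X`) is interchangeable with v5's (K2^ι)/(R2^ι) and the pen's (K2′): `ℓ_{ι𝔓}(I.H ⧸ Λs) =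
ℓ_𝔓(I′.H ⧸ Λ(e s))` (`lengthAt_quotient_span_twist_iwasawaH1Data`).

## What is proved

* §1 (namespace `…SignedKatoOffTwo.SemilinearTransport`, ring-agnostic): `lengthAt_quotient_eq_of_semilinear` (for
  `e : M ≃+ N` `σ`-semilinear and submodules `P`, `Q` with `Q = e(P)`: `ℓ_𝔭(M ⧸ P) = ℓ_𝔓(N ⧸ Q)`, `𝔭 = σ⁻¹𝔓`),
  `lengthAt_quotient_span_singleton_eq_of_semilinear` (`ℓ_𝔭(M ⧸ Rm) = ℓ_𝔓(N ⧸ S·e m)`).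
* §2 (namespace `…SignedKatoOffTwo.IwasawaInvolution`): `proj_invol_one_add_X_smul` (in `I`, `ι(1+T)` acts as `conj_δ` on
  every layer), **`exists_twist_iwasawaH1Data`** (abstract `ι`), **`exists_twist_iwasawaH1Data_invol`** (v5 spelling, with the
  length transport `ℓ_{ι𝔓}(I.H ⧸ Λs) = ℓ_𝔓(I′.H ⧸ Λ(e s))` and `I′.proj n (e x) = I.proj n x`).

References: [Kato2004Asterisque, §12.2 (p. 220), §13]; [GreenbergLNM1716, §1 p. 60]; [PerrinRiou1994, §1.3].
-/

set_option autoImplicit false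
-- the Theorems namespace of this sub repeats the summit name by design (D-0017 nested layout)
set_option linter.dupNamespace false

noncomputable section

open scoped Classical

namespace Summit.BirchSwinnertonDyer.BirchSwinnertonDyer.Theorems

/-! ## §1 Quotients by corresponding submodules -/

namespace SignedKatoOffTwo.SemilinearTransport

open Literature.NumberTheory.EllipticCurves Literature.NumberTheory.EllipticCurves.Module

universe u v w x

variable {R : Type u} {S : Type v} [CommRing R] [CommRing S] (σ : R ≃+* S)
  {M : Type w} {N : Type x} [AddCommGroup M] [Module R M] [AddCommGroup N] [Module S N]
  (e : M ≃+ N) {𝔭 : PrimeSpectrum R} {𝔓 : PrimeSpectrum S}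

/-- **`ℓ_𝔭(M ⧸ P) = ℓ_𝔓(N ⧸ Q)` when `Q = e(P)`** for a `σ`-semilinear additive isomorphism `e` and `𝔭 = σ⁻¹(𝔓)`. [folklore] -/
theorem lengthAt_quotient_eq_of_semilinear (he : ∀ (r : R) (m : M), e (r • m) = σ r • e m)
    (P : Submodule R M) (Q : Submodule S N) (hPQ : ∀ n, n ∈ Q ↔ e.symm n ∈ P)
    (h𝔭 : 𝔭.asIdeal = 𝔓.asIdeal.comap σ) :
    lengthAt R (M ⧸ P) 𝔭 = lengthAt S (N ⧸ Q) 𝔓 := by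
  let f : M →+ N ⧸ Q := Q.mkQ.toAddMonoidHom.comp e.toAddMonoidHom
  have hf_apply : ∀ m, f m = Q.mkQ (e m) := fun _ ↦ rfl
  have hf : ∀ (r : R) (m : M), f (r • m) = σ r • f m := fun r m ↦ by
    rw [hf_apply, hf_apply, he, map_smul]
  have hK : ∀ m, m ∈ P ↔ f m = 0 := fun m ↦ by
    rw [hf_apply, Submodule.mkQ_apply, Submodule.Quotient.mk_eq_zero, hPQ, e.symm_apply_apply]
  have hL : ∀ y, y ∈ (⊤ : Submodule S (N ⧸ Q)) ↔ y ∈ Set.range f := fun y ↦ by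
    simp only [Submodule.mem_top, true_iff]
    obtain ⟨n, rfl⟩ := Submodule.Quotient.mk_surjective Q y
    exact ⟨e.symm n, by rw [hf_apply, e.apply_symm_apply]; rfl⟩
  rw [lengthAt_quotient_ker_eq_lengthAt_range hf P hK ⊤ hL h𝔭]
  exact lengthAt_eq_of_linearEquiv Submodule.topEquiv 𝔓

/-- **`ℓ_𝔭(M ⧸ Rm) = ℓ_𝔓(N ⧸ S·(e m))`** for a `σ`-semilinear additive isomorphism `e` and `𝔭 = σ⁻¹(𝔓)`. [folklore] -/
theorem lengthAt_quotient_span_singleton_eq_of_semilinear (he : ∀ (r : R) (m : M), e (r • m) = σ r • e m)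
    (m : M) (h𝔭 : 𝔭.asIdeal = 𝔓.asIdeal.comap σ) :
    lengthAt R (M ⧸ Submodule.span R {m}) 𝔭 = lengthAt S (N ⧸ Submodule.span S {e m}) 𝔓 := by
  refine lengthAt_quotient_eq_of_semilinear σ e he _ _ (fun n ↦ ?_) h𝔭
  rw [Submodule.mem_span_singleton, Submodule.mem_span_singleton]
  constructor
  · rintro ⟨s, rfl⟩
    refine ⟨σ.symm s, e.injective ?_⟩
    rw [e.apply_symm_apply, he, σ.apply_symm_apply]
  · rintro ⟨r, hr⟩
    refine ⟨σ r, ?_⟩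
    rw [← he, hr, e.apply_symm_apply]

end SignedKatoOffTwo.SemilinearTransport

/-! ## §2 The twist of `Kato2004.IwasawaH1Data` -/

namespace SignedKatoOffTwo.IwasawaInvolution

open PowerSeries Field Literature.NumberTheory.GaloisRepresentations Literature.NumberTheory.EllipticCurves
  Literature.NumberTheory.EllipticCurves.Module Literature.NumberTheory.EllipticCurves.Kato2004
  Literature.NumberTheory.EllipticCurves.Kato2004.EulerSystemValues Literature.Barriers.BirchSwinnertonDyer ZpExtension

variable {W : WeierstrassCurve ℚ} [W.IsElliptic] {p : ℕ} [Fact p.Prime] [ContinuousSMul ℤ_[p] (W.tateModule p)]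
  {κ : ZpExtension ℚ p} {γ δ : absoluteGaloisGroup ℚ}
  (ι : IwasawaAlgebra p ≃+* IwasawaAlgebra p)
  (hι : ∀ f : IwasawaAlgebra p, ι f = subst (invOnePlusSubOne : ℤ_[p]⟦X⟧) f)
include hι

/-- **KEY COMPUTATION** in `I : IwasawaH1Data W p κ γ` (`T` acts as `conj_γ − 1` on each layer): the unit `ι(1+T) = (1+T)⁻¹`
acts as `conj_δ` for `γδ = 1` (`1 + T` acts as `conj_γ`; `conj_δ ∘ conj_γ = conj_1 = id`). [folklore] -/
theorem proj_invol_one_add_X_smul (hγδ : γ * δ = 1) (I : IwasawaH1Data W p κ γ) (n : ℕ) (x : I.H) :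
    I.proj n (ι (1 + X) • x) = conjMap (tateRep W p).toTopRep (κ.layerSubgroup n) δ 1 (I.proj n x) := by
  set y : I.H := ι (1 + X) • x with hy
  have hx : x = (1 + X : IwasawaAlgebra p) • y := by
    rw [hy, ← mul_smul, one_add_X_mul_invol ι hι, one_smul]
  have h1 : I.proj n ((1 + X : IwasawaAlgebra p) • y) =
      conjMap (tateRep W p).toTopRep (κ.layerSubgroup n) γ 1 (I.proj n y) := by
    rw [add_smul, one_smul, map_add, I.proj_T_smul, add_sub_cancel]
  have hδγ : δ * γ = 1 := by
    have : δ = γ⁻¹ := eq_inv_of_mul_eq_one_right hγδ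
    rw [this, inv_mul_cancel]
  conv_rhs => rw [hx, h1, ← conjMap_mul_apply_one, hδγ]
  have h1' := conjMap_one_apply_of_mem (tateRep W p).toTopRep (κ.layerSubgroup n) 1 (I.proj n y)
  rw [OneMemClass.coe_one] at h1'
  exact h1'.symm

/-- **THE TWIST `γ ↦ γ⁻¹` OF KATO's PINNED `𝐇¹` IS ITS `ι`-TWIST.** For `γδ = 1` and `I : IwasawaH1Data W p κ γ` there is
`I′ : IwasawaH1Data W p κ δ` on the same group with the same layer projections (`I′.proj n (e x) = I.proj n x`) and
`Λ`-structure twisted by `ι` (`e (f • x) = ι f • e x`). [cite: Kato2004Asterisque, §12.2 (p. 220)]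
[cite: GreenbergLNM1716, §1 p. 60] -/
theorem exists_twist_iwasawaH1Data (hγδ : γ * δ = 1) (I : IwasawaH1Data W p κ γ) :
    ∃ (I' : IwasawaH1Data W p κ δ) (e : I.H ≃+ I'.H),
      (∀ (f : IwasawaAlgebra p) (x : I.H), e (f • x) = ι f • e x) ∧
      ∀ (n : ℕ) (x : I.H), I'.proj n (e x) = I.proj n x := by
  refine ⟨@IwasawaH1Data.mk W _ p _ _ κ δ I.H I.addCommGroup
      (Module.compHom I.H (ι : IwasawaAlgebra p →+* IwasawaAlgebra p)) I.proj I.proj_mem I.cores_proj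
      I.proj_injective I.proj_surjective ?_ ?_, AddEquiv.refl I.H, ?_, ?_⟩
  · intro n x
    change I.proj n (ι X • x) = _
    rw [invol_X_eq_sub ι, sub_smul, one_smul, map_sub, proj_invol_one_add_X_smul ι hι hγδ I n x]
  · intro c n x
    change I.proj n (ι (C c) • x) = _
    rw [invol_C ι hι]
    exact I.proj_C_smul c n x
  · intro f x
    change f • x = ι (ι f) • x
    rw [invol_invol ι hι]
  · intro n x
    rfl

omit hι in
/-- **The twist in v5 spelling, with the length transport of `𝐇¹ ⧸ Λs`**: for `γδ = 1` and `I : IwasawaH1Data W p κ γ` there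
are `I′ : IwasawaH1Data W p κ δ` and `e : I.H ≃+ I′.H`, `IwasawaAlgebra.invol`-semilinear, preserving every `proj n`, with
`ℓ_{ι𝔓}(I.H ⧸ Λs) = ℓ_𝔓(I′.H ⧸ Λ(e s))` for every `s` and every prime `𝔓`. [cite: Kato2004Asterisque, §12.2 (p. 220)]
[cite: GreenbergLNM1716, §1 p. 60] -/
theorem exists_twist_iwasawaH1Data_invol (hγδ : γ * δ = 1) (I : IwasawaH1Data W p κ γ) :
    ∃ (I' : IwasawaH1Data W p κ δ) (e : I.H ≃+ I'.H),
      (∀ (f : IwasawaAlgebra p) (x : I.H), e (f • x) = IwasawaAlgebra.invol p f • e x) ∧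
      (∀ (n : ℕ) (x : I.H), I'.proj n (e x) = I.proj n x) ∧
      ∀ (s : I.H) (𝔓 : PrimeSpectrum (IwasawaAlgebra p)),
        lengthAt (IwasawaAlgebra p) (I.H ⧸ Submodule.span (IwasawaAlgebra p) {s})
            (PrimeSpectrum.comap (IwasawaAlgebra.invol p).toRingHom 𝔓) =
          lengthAt (IwasawaAlgebra p) (I'.H ⧸ Submodule.span (IwasawaAlgebra p) {e s}) 𝔓 := by
  obtain ⟨I', e, he, hproj⟩ := exists_twist_iwasawaH1Data _ (involEquiv_eq_subst p) hγδ I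
  refine ⟨I', e, fun f x ↦ he f x, hproj, fun s 𝔓 ↦ ?_⟩
  rw [primeSpectrum_comap_invol_eq]
  exact SemilinearTransport.lengthAt_quotient_span_singleton_eq_of_semilinear _ e he s rfl

end SignedKatoOffTwo.IwasawaInvolution

end Summit.BirchSwinnertonDyer.BirchSwinnertonDyer.Theorems

end
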